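import Mathlib.Data.Real.Basic
import Mathlib.Tactic.Linarith
import Mathlib.Tactic.Positivity
import Mathlib.Tactic.Ring
import Mathlib.Tactic.LinearCombination
import HarnessLib

/-!
# Venture HSemireg — the elementary steps of THEOREM (T1) «no real solution of the balanced-pair LI-2 class equation has Πc∕Πa < 0»
# (ENGINE-W code A, service for the S⁴ corner's row LI-2; note `widen/ENGINE-W/out/li2sign/X2-LI2-SIGN-A.md` §1)

HONEST FRAMING. Lean index of the computation cell `pub-hsemireg`, widening group ENGINE-W (code A, seat `engine-w-1`, gen 19).
ELEMENTARY REAL ALGEBRA ONLY. (T1) of the note: if real linear forms `ℓ_j = a_j x + ⟨b_j,y⟩`, `ℓ′_k = c_k x + ⟨b′_k,y⟩` (`j,k ≤ 4`, `y ∈ ℝ²`)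
satisfy `Πℓ_j − Πℓ′_k = q xⁿ + m zⁿ + m̄ z̄ⁿ` with `m ≠ 0`, then `t := Πc_k ∕ Πa_j` is never negative. Its proof has three steps, all kernel-checked
here as stand-alone statements about real numbers: (E) Newton's `p₂ = e₁² − 2e₂` turns the `x^{n−1}`, `x^{n−2}` coefficient identities
`e₁(u) = t·e₁(v)`, `e₂(u) = t·e₂(v)` into the Gram identity `Σ⟨u_j,y⟩² = t·Σ⟨v_k,y⟩² + t(t−1)⟨s,y⟩²` (`s = Σ v_k`); (B) at `y ⊥ s` and `t < 0`
a sum of squares equals `t ×` a sum of squares, so every `⟨u_j,y⟩`, `⟨v_k,y⟩` vanishes — all eight vectors are parallel to `s`; (C) the harmonic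
quartic `Re(m̄(y₁+iy₂)⁴) = c(y₁⁴ − 6y₁²y₂² + y₂⁴) + d(4y₁³y₂ − 4y₁y₂³)` is never `κ(αy₁ + βy₂)⁴` unless `c = d = 0` — so the right side cannot be
a function of the one coordinate `⟨s,y⟩`. What is NOT formalised: linear forms, the products, the coefficient extraction, or anything about classes,
cycles or abelian varieties; nothing here says that HC, HC_CM, HC_AV holds or that row LI-2 is closed. Theorems only (0 `def`, 0 named fact, 0 `sorry`).
New namespace `BalancedPairSign`.

* `powerSumTwo_of_e1_e2` — (E) for four + four reals. [kernel]
* `forms_vanish_of_neg` — (B): `t < 0`, `Σ m_j² = t·Σ n_k²` ⇒ all `m_j = n_k = 0`. [kernel]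
* `parallel_of_gram_identity` — (E)+(B) assembled on `ℝ²`: the Gram identity for all `y` with `t < 0` forces `u_j × s = v_k × s = 0`. [kernel]
* `harmonic_quartic_not_fourth_power` — (C). [kernel]
-/

namespace Summit.Ventures.HSemireg.BalancedPairSign

/-- **(E) Newton at order two.** If `Σ m = t·Σ n` and `e₂(m) = t·e₂(n)` for four + four reals, then
`Σ m² = t·Σ n² + t(t−1)(Σ n)²`. [kernel] -/
theorem powerSumTwo_of_e1_e2 (t m₁ m₂ m₃ m₄ n₁ n₂ n₃ n₄ : ℝ)
    (h1 : m₁ + m₂ + m₃ + m₄ = t * (n₁ + n₂ + n₃ + n₄))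
    (h2 : m₁ * m₂ + m₁ * m₃ + m₁ * m₄ + m₂ * m₃ + m₂ * m₄ + m₃ * m₄ =
      t * (n₁ * n₂ + n₁ * n₃ + n₁ * n₄ + n₂ * n₃ + n₂ * n₄ + n₃ * n₄)) :
    m₁ ^ 2 + m₂ ^ 2 + m₃ ^ 2 + m₄ ^ 2 =
      t * (n₁ ^ 2 + n₂ ^ 2 + n₃ ^ 2 + n₄ ^ 2) + t * (t - 1) * (n₁ + n₂ + n₃ + n₄) ^ 2 := by
  have hsq : (m₁ + m₂ + m₃ + m₄) ^ 2 = t ^ 2 * (n₁ + n₂ + n₃ + n₄) ^ 2 := by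
    rw [h1]; ring
  linear_combination hsq - 2 * h2

/-- **(B) Opposite signs.** For `t < 0`, `Σ_j m_j² = t·Σ_k n_k²` forces every `m_j` and every `n_k` to vanish. [kernel] -/
theorem forms_vanish_of_neg (t m₁ m₂ m₃ m₄ n₁ n₂ n₃ n₄ : ℝ) (ht : t < 0)
    (h : m₁ ^ 2 + m₂ ^ 2 + m₃ ^ 2 + m₄ ^ 2 = t * (n₁ ^ 2 + n₂ ^ 2 + n₃ ^ 2 + n₄ ^ 2)) :
    m₁ = 0 ∧ m₂ = 0 ∧ m₃ = 0 ∧ m₄ = 0 ∧ n₁ = 0 ∧ n₂ = 0 ∧ n₃ = 0 ∧ n₄ = 0 := by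
  have hm : 0 ≤ m₁ ^ 2 + m₂ ^ 2 + m₃ ^ 2 + m₄ ^ 2 := by positivity
  have hn : 0 ≤ n₁ ^ 2 + n₂ ^ 2 + n₃ ^ 2 + n₄ ^ 2 := by positivity
  have hN : n₁ ^ 2 + n₂ ^ 2 + n₃ ^ 2 + n₄ ^ 2 = 0 := by nlinarith
  have hM : m₁ ^ 2 + m₂ ^ 2 + m₃ ^ 2 + m₄ ^ 2 = 0 := by rw [hN] at h; linarith
  refine ⟨?_, ?_, ?_, ?_, ?_, ?_, ?_, ?_⟩ <;> nlinarith [sq_nonneg m₁, sq_nonneg m₂, sq_nonneg m₃, sq_nonneg m₄,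
    sq_nonneg n₁, sq_nonneg n₂, sq_nonneg n₃, sq_nonneg n₄]

/-- **(E)+(B) on `ℝ²`: the Gram identity with `t < 0` makes all eight vectors parallel to `s`.** Vectors as coordinate pairs
`u_j = (uj1, uj2)`, `v_k = (vk1, vk2)`, `s = (s₁, s₂)`; hypothesis = the Gram identity `Σ⟨u_j,y⟩² = t·Σ⟨v_k,y⟩² + t(t−1)⟨s,y⟩²` for
every `y = (y₁, y₂)`; conclusion = every cross product with `s` vanishes. [kernel] -/
theorem parallel_of_gram_identity (t s₁ s₂ : ℝ) (ht : t < 0)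
    (u11 u12 u21 u22 u31 u32 u41 u42 v11 v12 v21 v22 v31 v32 v41 v42 : ℝ)
    (hG : ∀ y₁ y₂ : ℝ,
      (u11 * y₁ + u12 * y₂) ^ 2 + (u21 * y₁ + u22 * y₂) ^ 2 + (u31 * y₁ + u32 * y₂) ^ 2 + (u41 * y₁ + u42 * y₂) ^ 2 =
        t * ((v11 * y₁ + v12 * y₂) ^ 2 + (v21 * y₁ + v22 * y₂) ^ 2 + (v31 * y₁ + v32 * y₂) ^ 2 + (v41 * y₁ + v42 * y₂) ^ 2) +
          t * (t - 1) * (s₁ * y₁ + s₂ * y₂) ^ 2) :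
    u11 * s₂ - u12 * s₁ = 0 ∧ u21 * s₂ - u22 * s₁ = 0 ∧ u31 * s₂ - u32 * s₁ = 0 ∧ u41 * s₂ - u42 * s₁ = 0 ∧
      v11 * s₂ - v12 * s₁ = 0 ∧ v21 * s₂ - v22 * s₁ = 0 ∧ v31 * s₂ - v32 * s₁ = 0 ∧ v41 * s₂ - v42 * s₁ = 0 := by
  have h := hG s₂ (-s₁)
  have hs : (s₁ * s₂ + s₂ * -s₁) ^ 2 = 0 := by ring
  rw [hs, mul_zero, add_zero] at h
  have key := forms_vanish_of_neg t (u11 * s₂ + u12 * -s₁) (u21 * s₂ + u22 * -s₁) (u31 * s₂ + u32 * -s₁)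
    (u41 * s₂ + u42 * -s₁) (v11 * s₂ + v12 * -s₁) (v21 * s₂ + v22 * -s₁) (v31 * s₂ + v32 * -s₁) (v41 * s₂ + v42 * -s₁) ht h
  obtain ⟨h1, h2, h3, h4, h5, h6, h7, h8⟩ := key
  refine ⟨?_, ?_, ?_, ?_, ?_, ?_, ?_, ?_⟩ <;> linarith

/-- **(C) A non-zero harmonic quartic is not a fourth power of one linear form.** For `(c, d) ≠ (0, 0)` the identity
`c(y₁⁴ − 6y₁²y₂² + y₂⁴) + d(4y₁³y₂ − 4y₁y₂³) = κ(αy₁ + βy₂)⁴` cannot hold for all `y`: the left side takes both signs on the six test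
points `(1,0), (1,1)` (values `c`, `−4c`) and `(1,2), (2,1)` (values `−7c − 24d`, `−7c + 24d`), the right side has the sign of `κ`. [kernel] -/
theorem harmonic_quartic_not_fourth_power (c d κ α β : ℝ) (hcd : c ≠ 0 ∨ d ≠ 0)
    (h : ∀ y₁ y₂ : ℝ,
      c * (y₁ ^ 4 - 6 * y₁ ^ 2 * y₂ ^ 2 + y₂ ^ 4) + d * (4 * y₁ ^ 3 * y₂ - 4 * y₁ * y₂ ^ 3) = κ * (α * y₁ + β * y₂) ^ 4) :
    False := by
  have h10 := h 1 0
  have h11 := h 1 1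
  have h12 := h 1 2
  have h21 := h 2 1
  norm_num at h10 h11 h12 h21
  -- h10 : c = κ α⁴ ; h11 : -4c = κ (α+β)⁴ ; h12 : -7c - 24 d = κ (α+2β)⁴ ; h21 : -7c + 24 d = κ (2α+β)⁴ (up to normalisation)
  have hc : c = 0 := by
    nlinarith [mul_self_nonneg (κ * (α * α) * ((α + β) * (α + β))), sq_nonneg c, sq_nonneg (α * α), sq_nonneg ((α + β) * (α + β))]
  have hd : d = 0 := by
    subst hc
    nlinarith [mul_self_nonneg (κ * ((α + 2 * β) * (α + 2 * β)) * ((2 * α + β) * (2 * α + β))), sq_nonneg d,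
      sq_nonneg ((α + 2 * β) * (α + 2 * β)), sq_nonneg ((2 * α + β) * (2 * α + β))]
  rcases hcd with hc' | hd'
  · exact hc' hc
  · exact hd' hd

end Summit.Ventures.HSemireg.BalancedPairSign
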